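import Mathlib.Analysis.Normed.Group.Ultra
import Mathlib.Topology.Algebra.ContinuousMonoidHom
import Mathlib.Analysis.SpecificLimits.Basic
import HarnessLib

/-!
# F0 · P3c · ROAD «HC-D» (holder F0P2-p01) — D2♭ «F-FORM SUBMERSION NEWTON DATA»: Newton data ON AN ADDITIVE SUBGROUP for a submersion whose splitting does not
# respect the subgroup (the unitary `F`-form `𝔲₀ ⊂ M₃(K)` and the target `A = K^σ × K^{−σ} ⊂ K × K`), from the AMBIENT strict estimate and a BOUNDED ADDITIVE SECTION

Cell `pub/hodgecm-mathlib`, crux H413 = `stmt-HodgeConjecture-24833` (lane `--supports … --as helper`), route HCCMUnconditional; ROAD «HC-D» brick D2♭ (architecture note ♭,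
F0∕P2 bus 2026-09-02T16:29Z).  THEOREMS ONLY, Mathlib-only, SCALAR-FREE (no field acts anywhere).  Consumer: D5(i) «regular points» (F0P3-p04): `P = χ′ = (trace ∘ adjugate, det)`
on `M = M₃(K)`, `S = 𝔲₀`, `A' = K × K`, `A = {(c,d) | σ c = c, σ d = −d}`, `L = dχ′_{X₀}` (★ D4a), section `t (c,d) = c • Y_c + (d λ⁻¹) • Y_d`; the output is exactly the `hN` of
★ FILE 2′ `F0P3cStCharTSNewtonCore.depth_chart_of_newtonData` on the carrier `S` (base point `0`, chart `Ψ`, linear part `E`), whence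
`∫⁻ s in Λ k, g (P (x₀ + s) − P x₀) ∂μ_S = ∫⁻ s in Λ k, g (L s) ∂μ_S`.
HONEST LABEL: HC_CM is proved only modulo the 7 printed citations (2 remaining named inputs: hLiu418 = `stmt-HodgeConjecture-24832`, h413 = `stmt-HodgeConjecture-24833`) until rung 0
closes; count-neutral.

THE LEMMA.  `M` ultrametric normed, `A'` normed, `P : M → A'`, `L : M →+ A'` continuous, `x₀ : M`; STRICT ESTIMATE at `x₀`:
`∀ ε > 0, ∃ δ > 0, ‖p − x₀‖ < δ → ‖q − x₀‖ < δ → ‖P p − P q − L (p − q)‖ ≤ ε‖p − q‖` (= `HasStrictFDerivAt` unfolded, over whatever field the ambient calculus used); subgroups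
`S ≤ M`, `A ≤ A'` with `P (x₀ + s) − P x₀ ∈ A`, `L s ∈ A` (`s ∈ S`); an ADDITIVE section `t : A → S` of `L` with `‖t a‖ ≤ C‖a‖`.  THEN with `K₀ := ker (L|_S)`,
`E s := (L s, s − t (L s)) : S ≃ₜ+ A × K₀` (inverse `(a, k) ↦ t a + k`) and `Ψ s := (P (x₀ + s) − P x₀, s − t (L s))`: for every `r > 0`, `γ ∈ (0,1)` there is `k₀` with
  `∀ k ≥ k₀, ∀ j ≥ k, ‖x‖ ≤ rγᵏ → ‖y‖ ≤ rγʲ → Ψ (0 + (x + y)) − Ψ (0 + x) − E y ∈ E '' closedBall 0 (rγ^{j+1})`   (all in `S`),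
because the defect is `(ρ, 0) = E (t ρ)` with `ρ = P (x₀+x+y) − P (x₀+x) − L y`, `‖t ρ‖ ≤ Cε‖y‖ ≤ rγ^{j+1}` once `Cε ≤ γ`.
* §1 `exists_splitting_addEquiv` — the equivalence `E` (∃-form, with its two coordinate formulas and the formula for the inverse).
* §2 **`exists_newtonData_submersion_addSubgroup`** — `E`, `Ψ`, their first∕second coordinates, `Ψ 0 = 0`, and the Newton data for all `r, γ`.

## References
* [Schikhof1984] W. H. Schikhof, *Ultrametric Calculus* (1984), §27 Lemma 27.4–Thm. 27.5, §77.
* [Serre1992LALG] J.-P. Serre, *Lie Algebras and Lie Groups*, LNM 1500 (1992), Part II Ch. III §10 (submersions), Ch. IV §9.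
-/

set_option autoImplicit false
-- the mandated namespace has the single-problem summit's repeated segment (`HodgeConjecture.HodgeConjecture`)
set_option linter.dupNamespace false

noncomputable section

open Filter Metric Set
open scoped Topology

namespace Summit.HodgeConjecture.HodgeConjecture.Cruxes.H413.F0P3cStCharTSSubmersionDescent

variable {M : Type*} [NormedAddCommGroup M] {A' : Type*} [NormedAddCommGroup A']

/-! ## §1 The splitting `S ≃ₜ+ A × ker (L|_S)` attached to a bounded additive section -/

/-- **Splitting of a subgroup along an additive surjection with a bounded additive section.**  `L : M →+ A'` continuous, `S ≤ M`, `A ≤ A'`, `L S ⊆ A`, `t : A → S` additive with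
`L (t a) = a` and `‖t a‖ ≤ C‖a‖`: then `s ↦ (L s, s − t (L s))` is a `ContinuousAddEquiv` `S ≃ₜ+ A × ker (L ∘ S.subtype)` with inverse `(a, k) ↦ t a + k`.
[cite: Serre1992LALG, Part II Ch. III §10] -/
theorem exists_splitting_addEquiv (S : AddSubgroup M) (A : AddSubgroup A') (L : M →+ A') (hLc : Continuous L) (hLS : ∀ s : S, L s ∈ A)
    (t : A → S) (ht : ∀ a b, t (a + b) = t a + t b) (hLt : ∀ a : A, L (t a : M) = a) {C : ℝ} (hC : ∀ a : A, ‖(t a : M)‖ ≤ C * ‖(a : A')‖) :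
    ∃ E : S ≃ₜ+ A × (L.comp S.subtype).ker,
      (∀ s : S, ((E s).1 : A') = L s) ∧ (∀ s : S, (((E s).2 : S) : M) = s - t ⟨L s, hLS s⟩) ∧
      (∀ (a : A) (k : (L.comp S.subtype).ker), E.symm (a, k) = t a + (k : S)) := by
  -- `t` is additive, hence `t 0 = 0`, `t (-a) = -t a`, and Lipschitz, hence continuous
  have ht0 : t 0 = 0 := by
    have h := ht 0 0
    simp only [add_zero] at h
    -- h : t 0 = t 0 + t 0
    have : t 0 + t 0 = t 0 + 0 := by rw [← h, add_zero]
    exact add_left_cancel this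
  have htsub : ∀ a b, t (a - b) = t a - t b := by
    intro a b
    have h := ht (a - b) b
    rw [sub_add_cancel] at h
    rw [h]; abel
  have htc : Continuous t := by
    -- `a ↦ (t a : M)` is Lipschitz, and `S` carries the induced topology
    have hval : Continuous (fun a : A => ((t a : S) : M)) := by
      refine (LipschitzWith.of_dist_le_mul (K := C.toNNReal) fun a b => ?_).continuous
      rw [Real.coe_toNNReal', dist_eq_norm, Subtype.dist_eq, dist_eq_norm]
      have h1 : ((t a : S) : M) - ((t b : S) : M) = ((t (a - b) : S) : M) := by
        rw [htsub]; rfl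
      rw [h1]
      calc ‖((t (a - b) : S) : M)‖ ≤ C * ‖((a - b : A) : A')‖ := hC (a - b)
        _ ≤ max C 0 * ‖((a - b : A) : A')‖ := mul_le_mul_of_nonneg_right (le_max_left _ _) (norm_nonneg _)
        _ = max C 0 * ‖(a : A') - (b : A')‖ := rfl
    exact Topology.IsInducing.subtypeVal.continuous_iff.2 hval
  -- the kernel component
  have hker : ∀ s : S, s - t ⟨L s, hLS s⟩ ∈ (L.comp S.subtype).ker := by
    intro s
    simp only [AddMonoidHom.mem_ker, AddMonoidHom.comp_apply, AddSubgroup.coe_subtype, map_sub,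
      hLt, sub_self]
  let toF : S → A × (L.comp S.subtype).ker := fun s => (⟨L s, hLS s⟩, ⟨s - t ⟨L s, hLS s⟩, hker s⟩)
  let invF : A × (L.comp S.subtype).ker → S := fun p => t p.1 + (p.2 : S)
  have hleft : Function.LeftInverse invF toF := by
    intro s
    simp only [toF, invF]
    abel
  have hright : Function.RightInverse invF toF := by
    rintro ⟨a, ⟨k, hk⟩⟩
    have hk' : L (k : M) = 0 := by simpa [AddMonoidHom.mem_ker] using hk
    have hLsum : (⟨L ((t a : S) + k : S), hLS _⟩ : A) = a := by
      apply Subtype.ext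
      simp only [AddSubgroup.coe_add, map_add, hLt, hk', add_zero]
    simp only [toF, invF]
    ext1
    · exact hLsum
    · apply Subtype.ext
      simp only
      rw [hLsum]
      abel
  let Eadd : S ≃+ A × (L.comp S.subtype).ker :=
    { toFun := toF, invFun := invF, left_inv := hleft, right_inv := hright,
      map_add' := by
        intro s s'
        have key : t ⟨L ((s + s' : S) : M), hLS (s + s')⟩ = t ⟨L s, hLS s⟩ + t ⟨L s', hLS s'⟩ := by
          rw [← ht]; congr 1; apply Subtype.ext; simp [map_add]
        simp only [toF]
        ext1
        · apply Subtype.ext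
          simp [map_add]
        · apply Subtype.ext
          show (s + s' : S) - t ⟨L ((s + s' : S) : M), hLS (s + s')⟩ = (s - t ⟨L s, hLS s⟩) + (s' - t ⟨L s', hLS s'⟩)
          rw [key]; abel }
  have hcont : Continuous toF := by
    refine Continuous.prodMk ?_ ?_
    · exact (hLc.comp continuous_subtype_val).subtype_mk _
    · refine Continuous.subtype_mk ?_ _
      exact continuous_id.sub (htc.comp ((hLc.comp continuous_subtype_val).subtype_mk _))
  have hcont' : Continuous invF :=
    (htc.comp continuous_fst).add (continuous_subtype_val.comp continuous_snd)
  let E : S ≃ₜ+ A × (L.comp S.subtype).ker :=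
    { Eadd with continuous_toFun := hcont, continuous_invFun := hcont' }
  refine ⟨E, fun s => rfl, fun s => rfl, fun a k => rfl⟩

/-! ## §2 Newton data on the subgroup -/

variable [IsUltrametricDist M]

/-- **F-FORM SUBMERSION NEWTON DATA.**  Under the hypotheses of the module docstring there are `E : S ≃ₜ+ A × ker (L ∘ S.subtype)` and `Ψ : S → A × ker (L ∘ S.subtype)` with
`(E s).1 = L s`, `(Ψ s).1 = P (x₀ + s) − P x₀`, `(Ψ s).2 = (E s).2`, `Ψ 0 = 0`, and for all `r > 0`, `0 < γ < 1` a depth `k₀` such that for `k ≥ k₀`, `j ≥ k`,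
`x ∈ closedBall (0:S) (rγᵏ)`, `y ∈ closedBall (0:S) (rγʲ)`: `Ψ (0 + (x + y)) − Ψ (0 + x) − E y ∈ E '' closedBall (0:S) (rγ^{j+1})` — the `hN` of
★ `F0P3cStCharTSNewtonCore.depth_chart_of_newtonData` on the carrier `S`. [cite: Schikhof1984, §27 Lemma 27.4–Thm. 27.5] [cite: Serre1992LALG, Part II Ch. III §10] -/
theorem exists_newtonData_submersion_addSubgroup (S : AddSubgroup M) (A : AddSubgroup A') (P : M → A') (L : M →+ A') (hLc : Continuous L) (x₀ : M)
    (hP : ∀ ε > 0, ∃ δ > 0, ∀ p q : M, ‖p - x₀‖ < δ → ‖q - x₀‖ < δ → ‖P p - P q - L (p - q)‖ ≤ ε * ‖p - q‖)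
    (hPS : ∀ s : S, P (x₀ + s) - P x₀ ∈ A) (hLS : ∀ s : S, L s ∈ A)
    (t : A → S) (ht : ∀ a b, t (a + b) = t a + t b) (hLt : ∀ a : A, L (t a : M) = a) {C : ℝ} (hC : ∀ a : A, ‖(t a : M)‖ ≤ C * ‖(a : A')‖) :
    ∃ (E : S ≃ₜ+ A × (L.comp S.subtype).ker) (Ψ : S → A × (L.comp S.subtype).ker),
      (∀ s : S, ((E s).1 : A') = L s) ∧ (∀ s : S, (((E s).2 : S) : M) = s - t ⟨L s, hLS s⟩) ∧
      (∀ (a : A) (k : (L.comp S.subtype).ker), E.symm (a, k) = t a + (k : S)) ∧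
      (∀ s : S, ((Ψ s).1 : A') = P (x₀ + s) - P x₀) ∧ (∀ s : S, (Ψ s).2 = (E s).2) ∧ Ψ 0 = 0 ∧
      ∀ {r γ : ℝ}, 0 < r → 0 < γ → γ < 1 → ∃ k₀ : ℕ, ∀ k, k₀ ≤ k → ∀ j, k ≤ j →
        ∀ x ∈ closedBall (0 : S) (r * γ ^ k), ∀ y ∈ closedBall (0 : S) (r * γ ^ j),
          Ψ (0 + (x + y)) - Ψ (0 + x) - E y ∈ (E : S → A × (L.comp S.subtype).ker) '' closedBall (0 : S) (r * γ ^ (j + 1)) := by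
  obtain ⟨E, hE1, hE2, hEsymm⟩ := exists_splitting_addEquiv S A L hLc hLS t ht hLt hC
  have ht0 : t 0 = 0 := by
    have h := ht 0 0
    simp only [add_zero] at h
    have : t 0 + t 0 = t 0 + 0 := by rw [← h, add_zero]
    exact add_left_cancel this
  let Ψ : S → A × (L.comp S.subtype).ker := fun s => (⟨P (x₀ + s) - P x₀, hPS s⟩, (E s).2)
  refine ⟨E, Ψ, hE1, hE2, hEsymm, fun s => rfl, fun s => rfl, ?_, ?_⟩
  · -- Ψ 0 = 0
    ext1
    · apply Subtype.ext; simp [Ψ]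
    · simp [Ψ]
  · intro r γ hr hγ0 hγ1
    -- choose ε with C ε ≤ γ, then δ, then the depth
    set C' := max C 0 with hC'
    have hC'0 : 0 ≤ C' := le_max_right _ _
    have hCle : ∀ a : A, ‖(t a : M)‖ ≤ C' * ‖(a : A')‖ := fun a =>
      (hC a).trans (mul_le_mul_of_nonneg_right (le_max_left _ _) (norm_nonneg _))
    obtain ⟨δ, hδ, hest⟩ := hP (γ / (C' + 1)) (div_pos hγ0 (by linarith))
    obtain ⟨k₀, hk₀⟩ := exists_pow_lt_of_lt_one (div_pos hδ hr) hγ1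
    have hk₀' : r * γ ^ k₀ < δ := by
      calc r * γ ^ k₀ < r * (δ / r) := mul_lt_mul_of_pos_left hk₀ hr
        _ = δ := mul_div_cancel₀ δ hr.ne'
    refine ⟨k₀, fun k hk j hj x hx y hy => ?_⟩
    replace hx := (mem_closedBall_zero_iff).1 hx
    replace hy := (mem_closedBall_zero_iff).1 hy
    have hγk : r * γ ^ k ≤ r * γ ^ k₀ := mul_le_mul_of_nonneg_left (pow_le_pow_of_le_one hγ0.le hγ1.le hk) hr.le
    have hγj : r * γ ^ j ≤ r * γ ^ k := mul_le_mul_of_nonneg_left (pow_le_pow_of_le_one hγ0.le hγ1.le hj) hr.le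
    have hxM : ‖(x : M)‖ < δ := lt_of_le_of_lt (hx.trans hγk) hk₀'
    have hyM : ‖(y : M)‖ ≤ r * γ ^ j := hy
    have hxyM : ‖(x : M) + y‖ < δ := by
      refine lt_of_le_of_lt (IsUltrametricDist.norm_add_le_max _ _) (max_lt hxM ?_)
      exact lt_of_le_of_lt ((hyM.trans hγj).trans hγk) hk₀'
    -- the defect
    set ρ : A' := P (x₀ + ((x : M) + y)) - P (x₀ + x) - L (y : M) with hρ
    have hρA : ρ ∈ A := by
      have h1 : P (x₀ + ((x : M) + y)) - P x₀ ∈ A := by simpa using hPS (x + y)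
      have h2 : P (x₀ + (x : M)) - P x₀ ∈ A := hPS x
      have : ρ = (P (x₀ + ((x : M) + y)) - P x₀) - (P (x₀ + (x : M)) - P x₀) - L (y : M) := by rw [hρ]; abel
      rw [this]
      exact A.sub_mem (A.sub_mem h1 h2) (hLS y)
    have hρest : ‖ρ‖ ≤ γ / (C' + 1) * ‖(y : M)‖ := by
      have h := hest (x₀ + ((x : M) + y)) (x₀ + x) (by simpa using hxyM) (by simpa using hxM)
      have hsub : x₀ + ((x : M) + y) - (x₀ + x) = y := by abel
      rw [hsub] at h
      simpa [hρ] using h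
    -- the preimage `z := t ρ`
    refine ⟨t ⟨ρ, hρA⟩, ?_, ?_⟩
    · refine (mem_closedBall_zero_iff).2 ?_
      show ‖((t ⟨ρ, hρA⟩ : S) : M)‖ ≤ r * γ ^ (j + 1)
      calc ‖((t ⟨ρ, hρA⟩ : S) : M)‖ ≤ C' * ‖ρ‖ := hCle ⟨ρ, hρA⟩
        _ ≤ C' * (γ / (C' + 1) * ‖(y : M)‖) := mul_le_mul_of_nonneg_left hρest hC'0
        _ ≤ γ * ‖(y : M)‖ := by
            have h1 : C' * (γ / (C' + 1)) ≤ γ := by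
              rw [mul_div_assoc']
              rw [div_le_iff₀ (by linarith)]
              nlinarith [hγ0.le]
            calc C' * (γ / (C' + 1) * ‖(y : M)‖) = (C' * (γ / (C' + 1))) * ‖(y : M)‖ := by ring
              _ ≤ γ * ‖(y : M)‖ := mul_le_mul_of_nonneg_right h1 (norm_nonneg _)
        _ ≤ γ * (r * γ ^ j) := mul_le_mul_of_nonneg_left hyM hγ0.le
        _ = r * γ ^ (j + 1) := by ring
    · -- `E (t ρ) = (ρ, 0) = Ψ (x + y) − Ψ x − E y`
      have hE_t : E (t ⟨ρ, hρA⟩) = (⟨ρ, hρA⟩, 0) := by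
        have := hEsymm ⟨ρ, hρA⟩ 0
        simp only [ZeroMemClass.coe_zero, add_zero] at this
        rw [← this, ContinuousAddEquiv.apply_symm_apply]
      rw [hE_t]
      simp only [zero_add]
      ext1
      · apply Subtype.ext
        simp only [Ψ, Prod.fst_sub, AddSubgroup.coe_sub, hE1, hρ, AddSubgroup.coe_add, map_add]
        abel
      · simp only [Ψ, Prod.snd_sub, map_add, Prod.snd_add]
        abel

end Summit.HodgeConjecture.HodgeConjecture.Cruxes.H413.F0P3cStCharTSSubmersionDescent

end
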